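import Summits.QuantumFields.QCD.Theorems.QuarksAsStableActionStableActionBridgeSmitTransferForm
import Literature.MathematicalPhysics.QuantumFieldTheory.QCDTimeReflection

/-!
# The time-ANTIPERIODIC Wilson fermion determinant in Smit's slice vocabulary: the honest trace
(crux `QuarksAsStableAction.StableActionBridge`, item stmt-QuantumFields-9737, line `Sketch`;
registered stub `wilsonDiracAP_det_eq_smit_transfer_form`, the antiperiodic twin of capstone A
`wilson_det_eq_smit_transfer_form`)

For a four-torus `SU(3)` gauge field `U` on `(ℤ/L)⁴` (`L ≥ 1`), one flavour of `r = 1` Wilson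
quarks of bare mass `m > −1` in the fundamental representation, with the time-ANTIPERIODIC
boundary condition of `QCDTimeReflection.wilsonDiracAP` (the temporal links of the layer
`t = ⌊L/2⌋ → ⌊L/2⌋ + 1` enter the hops with the Montvay–Münster sign `b = −1`, (4.112)–(4.115)),

  `det D_W^{AP}[U] = ∏_t det A(U_t)² · det (1 + ∏_{t=0}^{L−1} M_F(U_t) G_t)`,

with `U_t : (x⃗, j) ↦ U((t, x⃗), j+1)` the slice configuration, `A(U_t) = sliceMassHop U_t m`
(Dirac-sea factor `(det A_red)²` of Smit's `T̂_F(U_t) = (det A_red)² Γ(M_F(U_t))`, (6.91)),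
`M_F(U_t) = fermionSliceMatrix U_t m` the one-particle matrix of the fermionic transfer operator
and `G_t = sliceGaugeRot (y ↦ U((t, y), 0))` the one-particle gauge rotation by the temporal
links.  Antiperiodic time turns the `det (1 − ·)` (the `(−1)^F`-twisted Fock trace) of the
periodic capstone A into the honest trace `det (1 + ·) = Tr Γ(·)` ((4.34): "the negative sign …
will imply antiperiodicity in time for the Grassmann variables").

Proof (the signed-representation trick).  The antiperiodic operator of `U` IS the periodic
Wilson–Dirac operator of the `U(3)` field `V` obtained from `U` by negating, in `U(3)`, the
temporal links of the boundary layer (`wilsonDiracAP_eq_wilsonDirac`; the backward hops see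
`(−u)⁻¹ = −u⁻¹`).  Lüscher's form `wilson_det_transfer_form` holds for ANY group and unitary
representation, so it applies to the defining representation of `U(3)` and `V`:
`det = (∏_t det E_t) · det (1 − ∏_{i<L} M_i W_i)`.  The spatial links of `V` are those of `U`, so
the slice blocks `A_t, B_t, M_t` are literally those of capstone A (`dressedCore_timeSlice_eq`,
`sliceBlock_eq_reindex_sliceMassHop`); the chain blocks have
`det E_t = det(w′_{t−1})² det(B_t)²` (`det_wilson_chainBlock`) with `det(w′)² = 1` (blocks
`±V⁻¹`, `V ∈ SU(3)`, `det(±V⁻¹)² = 1`); the temporal transporters are `W_i = s_i · reindex G_i`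
with `s_i = −1` exactly for `i = ⌊L/2⌋ < L`, so `∏_{i<L} s_i = −1` comes out of the ordered
product and `det (1 − (−P)) = det (1 + P)`; finally the spin rotation `1 ⊗ γ₄γ₅` telescopes out
exactly as in capstone A (`det_one_sub_prod_reindex_conj`).  Pure theorem file (no definitions).

References: I. Montvay, G. Münster, *Quantum Fields on a Lattice* (CUP 1994), §4.1.3 (4.34) and
§4.2.4 (4.112)–(4.115) [MontvayMunster1994, §4.1.3 (4.34), §4.2.4 (4.112)–(4.115)];
M. Lüscher, Commun. Math. Phys. 54 (1977) 283 [Luscher1977, pp. 283–292]; J. Smit,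
*Introduction to Quantum Fields on a Lattice*, §6.5 (6.87)–(6.91) [Smit2023, §6.5 (6.87)–(6.91)].
-/

noncomputable section

namespace Summit.QuantumFields.QCD.Cruxes.StableActionBridge.Sketch

open MeasureTheory Matrix Literature.MathematicalPhysics.QuantumFieldTheory
  Literature.MathematicalPhysics.QuantumLattice
open Literature.Probability.LatticeModels (TorusSite)

namespace APSmitTransferForm

/-! ### The signed-representation trick: antiperiodic quarks = periodic quarks in a twisted field -/

/-- The links of the time-twisted `U(N)` field `V` (the `SU(N)` links of `U`, negated in `U(N)`
on the temporal boundary layer `t = ⌊L/2⌋`) in the defining representation are the `SU(N)` links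
weighted by the antiperiodic sign `apLinkSign`. [cite: MontvayMunster1994, §4.2.4 (4.112)–(4.115)] -/
theorem rep_twist_apply {N L : ℕ} (U : GaugeConfig 4 L (Matrix.specialUnitaryGroup (Fin N) ℂ))
    (V : GaugeConfig 4 L (Matrix.unitaryGroup (Fin N) ℂ))
    (hV : ∀ x μ, V (x, μ) = if μ = 0 ∧ (x 0).val = L / 2 then -unitaryLift U (x, μ)
      else unitaryLift U (x, μ)) (x : TorusSite 4 L) (μ : Fin 4) :
    unitaryFundamentalRep (Fin N) ℂ (V (x, μ)) =
      apLinkSign L x μ • fundamentalRep (Fin N) (U (x, μ)) := by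
  rw [hV, apLinkSign]
  split_ifs
  · rw [unitaryFundamentalRep_apply, Unitary.coe_neg, neg_one_smul]
    rfl
  · rw [one_smul]
    rfl

/-- The inverse links of the time-twisted `U(N)` field in the defining representation are the
inverse `SU(N)` links weighted by the antiperiodic sign (`(−u)⁻¹ = −u⁻¹` in `U(N)`).
[cite: MontvayMunster1994, §4.2.4 (4.112)–(4.115)] -/
theorem rep_twist_inv {N L : ℕ} (U : GaugeConfig 4 L (Matrix.specialUnitaryGroup (Fin N) ℂ))
    (V : GaugeConfig 4 L (Matrix.unitaryGroup (Fin N) ℂ))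
    (hV : ∀ x μ, V (x, μ) = if μ = 0 ∧ (x 0).val = L / 2 then -unitaryLift U (x, μ)
      else unitaryLift U (x, μ)) (x : TorusSite 4 L) (μ : Fin 4) :
    unitaryFundamentalRep (Fin N) ℂ (V (x, μ))⁻¹ =
      apLinkSign L x μ • fundamentalRep (Fin N) (U (x, μ))⁻¹ := by
  rw [hV, apLinkSign]
  split_ifs
  · rw [unitary_neg_inv, unitaryFundamentalRep_apply, Unitary.coe_neg, neg_one_smul]
    rfl
  · rw [one_smul]
    rfl

/-- **Antiperiodic quarks are periodic quarks in the time-twisted `U(N)` field**: entrywise,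
`wilsonDiracAP ρ U m r = wilsonDirac ρ_{U(N)} V m r` for the defining representations, `V` the
`U(N)` field of `U` with the temporal links of the boundary layer `t = ⌊L/2⌋` negated
(Montvay–Münster's sign factors `b = −1` moved onto the links).
[cite: MontvayMunster1994, §4.2.4 (4.112)–(4.115)] -/
theorem wilsonDiracAP_eq_wilsonDirac {N L : ℕ}
    (U : GaugeConfig 4 L (Matrix.specialUnitaryGroup (Fin N) ℂ))
    (V : GaugeConfig 4 L (Matrix.unitaryGroup (Fin N) ℂ))
    (hV : ∀ x μ, V (x, μ) = if μ = 0 ∧ (x 0).val = L / 2 then -unitaryLift U (x, μ)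
      else unitaryLift U (x, μ)) (m r : ℝ) :
    wilsonDiracAP (fundamentalRep (Fin N)) U m r =
      wilsonDirac (unitaryFundamentalRep (Fin N) ℂ) V m r := by
  ext p q
  simp only [Literature.MathematicalPhysics.QuantumFieldTheory.wilsonDiracAP,
    Literature.MathematicalPhysics.QuantumLattice.wilsonDirac, Matrix.of_apply]
  refine congr_arg _ (congr_arg _ (Finset.sum_congr rfl fun μ _ => ?_))
  rw [rep_twist_apply U V hV p.1 μ, rep_twist_inv U V hV q.1 μ, Matrix.smul_apply,
    Matrix.smul_apply, smul_eq_mul, smul_eq_mul]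
  congr 1
  · split_ifs
    · ring
    · rfl
  · split_ifs
    · ring
    · rfl

/-! ### The twisted temporal links: `det(w′)² = 1` and `W_t = ± reindex G_t` -/

/-- **`det(w′_s)² = 1`** for the site-block-diagonal colour matrix `w′_s` of the inverse temporal
links of slice `s` of the time-twisted field: its blocks are `±V⁻¹` with `V ∈ SU(N)`, and
`det(±V⁻¹)² = ((−1)^N)² = 1`. [folklore] -/
theorem det_invTimeLink_sq {N L : ℕ} [NeZero L]
    (U : GaugeConfig 4 L (Matrix.specialUnitaryGroup (Fin N) ℂ))
    (V : GaugeConfig 4 L (Matrix.unitaryGroup (Fin N) ℂ))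
    (hV : ∀ x μ, V (x, μ) = if μ = 0 ∧ (x 0).val = L / 2 then -unitaryLift U (x, μ)
      else unitaryLift U (x, μ)) (s : ZMod L) :
    (Matrix.of fun p q : TorusSite 3 L × Fin N =>
        if p.1 = q.1 then
          unitaryFundamentalRep (Fin N) ℂ (V ((Fin.cons s p.1 : TorusSite 4 L), 0))⁻¹ p.2 q.2
        else 0).det ^ 2 = 1 := by
  rw [APChainBlockPos.det_of_siteBlockDiag fun x : TorusSite 3 L =>
      unitaryFundamentalRep (Fin N) ℂ (V ((Fin.cons s x : TorusSite 4 L), 0))⁻¹, ← Finset.prod_pow]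
  refine Finset.prod_eq_one fun x _ => ?_
  have hU : (fundamentalRep (Fin N) (U ((Fin.cons s x : TorusSite 4 L), 0))⁻¹).det = 1 :=
    (Matrix.mem_specialUnitaryGroup_iff.1 (U ((Fin.cons s x : TorusSite 4 L), 0))⁻¹.2).2
  rw [rep_twist_inv U V hV _ 0, apLinkSign]
  split_ifs
  · rw [neg_one_smul, Matrix.det_neg, hU, mul_one, ← pow_mul, pow_mul', neg_one_sq, one_pow]
  · rw [one_smul, hU, one_pow]

/-- **`W_t = s_t · reindex G_t`**: the temporal transporter of `wilson_det_transfer_form` at time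
`t` for the time-twisted `U(3)` field is Smit's one-particle gauge rotation `sliceGaugeRot` by the
temporal `SU(3)` links `y ↦ U((t, y), 0)` (reindexed along `Fin 1 × X ≃ X`,
`SmitTransferForm.transporter_eq_reindex`), times the boundary sign `s_t = −1` iff `t = ⌊L/2⌋`.
[cite: Smit2023, §4.6 (4.124)–(4.126)] -/
theorem transporter_eq_smul_reindex {L : ℕ} [NeZero L]
    (U : GaugeConfig 4 L (Matrix.specialUnitaryGroup (Fin 3) ℂ))
    (V : GaugeConfig 4 L (Matrix.unitaryGroup (Fin 3) ℂ))
    (hV : ∀ x μ, V (x, μ) = if μ = 0 ∧ (x 0).val = L / 2 then -unitaryLift U (x, μ)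
      else unitaryLift U (x, μ)) (t : ZMod L) :
    (Matrix.of fun a b : TorusSite 3 L × Fin 3 × Fin 4 =>
        if a.1 = b.1 ∧ a.2.2 = b.2.2 then
          unitaryFundamentalRep (Fin 3) ℂ (V ((Fin.cons t a.1 : TorusSite 4 L), 0)) a.2.1 b.2.1
        else 0) =
      (if t.val = L / 2 then (-1 : ℂ) else 1) •
        Matrix.reindex (Equiv.uniqueProd (TorusSite 3 L × Fin 3 × Fin 4) (Fin 1))
          (Equiv.uniqueProd (TorusSite 3 L × Fin 3 × Fin 4) (Fin 1))
          (sliceGaugeRot (Nf := 1) fun y : TorusSite 3 L =>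
            U ((Fin.cons t y : TorusSite 4 L), 0)) := by
  rw [← SmitTransferForm.transporter_eq_reindex L U t]
  ext a b
  rw [Matrix.smul_apply, Matrix.of_apply, Matrix.of_apply, smul_eq_mul]
  split_ifs with hab ht ht
  · rw [rep_twist_apply U V hV _ 0, apLinkSign, Fin.cons_zero, if_pos ⟨rfl, ht⟩, Matrix.smul_apply,
      smul_eq_mul]
  · rw [rep_twist_apply U V hV _ 0, apLinkSign, Fin.cons_zero, if_neg (fun h => ht h.2),
      Matrix.smul_apply, smul_eq_mul]
  · rw [mul_zero]
  · rw [mul_zero]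

/-! ### Pulling the boundary signs out of the time-ordered product -/

/-- `reindex e e (c • A) = c • reindex e e A`. [folklore] -/
theorem reindex_smul {m n : Type*} (e : m ≃ n) (c : ℂ) (A : Matrix m m ℂ) :
    Matrix.reindex e e (c • A) = c • Matrix.reindex e e A := rfl

/-- Moving a scalar from the transporter onto the conjugated one-particle matrix:
`reindex (V₀ Y V₀') · (c · reindex Z) = reindex (V₀ (c Y) V₀') · reindex Z`. [folklore] -/
theorem reindex_conj_mul_smul {m n : Type*} [Fintype m] [Fintype n] (e : m ≃ n) (c : ℂ)
    (V₀ Y V₀' Z : Matrix m m ℂ) :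
    Matrix.reindex e e (V₀ * Y * V₀') * (c • Matrix.reindex e e Z) =
      Matrix.reindex e e (V₀ * (c • Y) * V₀') * Matrix.reindex e e Z := by
  simp only [Matrix.mul_smul, Matrix.smul_mul, reindex_smul]

/-- Scalars come out of an ordered product of matrices:
`∏_{i<L} (s_i · Y_i) = (∏_{i<L} s_i) · ∏_{i<L} Y_i` (ordered `List` product over `List.range L`).
[folklore] -/
theorem prod_map_smul {n : Type*} [Fintype n] [DecidableEq n] (s : ℕ → ℂ) (Y : ℕ → Matrix n n ℂ) :
    ∀ L : ℕ, ((List.range L).map fun i => s i • Y i).prod =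
      (∏ i ∈ Finset.range L, s i) • ((List.range L).map Y).prod
  | 0 => by
    rw [List.range_zero, List.map_nil, List.map_nil, List.prod_nil, Finset.prod_range_zero,
      one_smul]
  | L + 1 => by
    rw [List.range_succ, List.map_append, List.map_append, List.prod_append, List.prod_append,
      List.map_singleton, List.map_singleton, List.prod_singleton, List.prod_singleton,
      prod_map_smul s Y L, Finset.prod_range_succ, Matrix.smul_mul, Matrix.mul_smul, smul_smul,
      mul_comm]

/-- **The boundary signs multiply to `−1`**: among `i = 0, …, L − 1` exactly one, `i = ⌊L/2⌋ < L`
(`L ≥ 1`), has residue of value `⌊L/2⌋` in `ZMod L`, so `∏_{i<L} s_i = −1`. [folklore] -/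
theorem prod_sign (L : ℕ) [NeZero L] :
    ∏ i ∈ Finset.range L, (if ((i : ℕ) : ZMod L).val = L / 2 then (-1 : ℂ) else 1) = -1 := by
  rw [Finset.prod_congr rfl fun (i : ℕ) (hi : i ∈ Finset.range L) =>
      show (if ((i : ℕ) : ZMod L).val = L / 2 then (-1 : ℂ) else 1) =
          if i = L / 2 then (-1 : ℂ) else 1 by
        rw [ZMod.val_natCast, Nat.mod_eq_of_lt (Finset.mem_range.1 hi)],
    Finset.prod_ite_eq',
    if_pos (Finset.mem_range.2 (Nat.div_lt_self (Nat.pos_of_ne_zero (NeZero.ne L)) one_lt_two))]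

end APSmitTransferForm

/-- **Stub `wilsonDiracAP_det_eq_smit_transfer_form` of line `Sketch` (antiperiodic twin of
capstone A): the time-antiperiodic Wilson fermion determinant in Smit's slice vocabulary is the
honest-trace form.**  For an `SU(3)` gauge field `U` on the four-torus `(ℤ/L)⁴`, one flavour of
`r = 1` Wilson quarks of bare mass `m > −1` (fundamental representation) with time-antiperiodic
boundary condition (`wilsonDiracAP`: the temporal links of the layer `⌊L/2⌋ → ⌊L/2⌋+1` carry the
sign `−1`),
`det D_W^{AP}[U] = ∏_t det A(U_t)² · det (1 + ∏_{t=0}^{L−1} M_F(U_t) G_t)` with `U_t` the slice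
configuration `(x⃗, j) ↦ U((t, x⃗), j+1)`, `A(U_t) = sliceMassHop U_t m` (Dirac-sea factor
`(det A_red)²` of `T̂_F(U_t)`), `M_F(U_t) = fermionSliceMatrix U_t m` the one-particle matrix of the
fermionic transfer operator and `G_t = sliceGaugeRot (y ↦ U((t, y), 0))` the one-particle gauge
rotation by the temporal links; the single boundary sign turns the periodic `det (1 − ·)`
(supertrace) of `wilson_det_eq_smit_transfer_form` into the trace form `det (1 + ·)`.
[cite: MontvayMunster1994, §4.1.3 (4.34), §4.2.4 (4.112)–(4.115)] [cite: Luscher1977, pp. 283–292]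
[cite: Smit2023, §6.5 (6.87)–(6.91)] -/
theorem wilsonDiracAP_det_eq_smit_transfer_form : ∀ (L : ℕ) [NeZero L] (U : GaugeConfig 4 L (Matrix.specialUnitaryGroup (Fin 3) ℂ)) (m : ℝ), -1 < m → (wilsonDiracAP (fundamentalRep (Fin 3)) U m 1).det = (∏ t : ZMod L, (sliceMassHop (fun e : Edge 3 L => U ((Fin.cons t e.1 : TorusSite 4 L), e.2.succ)) (fun _ : Fin 1 => m)).det ^ 2) * (1 + ((List.range L).map fun i : ℕ => fermionSliceMatrix (fun e : Edge 3 L => U ((Fin.cons (i : ZMod L) e.1 : TorusSite 4 L), e.2.succ)) (fun _ : Fin 1 => m) * sliceGaugeRot (Nf := 1) (fun y : TorusSite 3 L => U ((Fin.cons (i : ZMod L) y : TorusSite 4 L), 0))).prod).det := by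
  intro L _ U m hm
  -- (0) the signed-representation trick: couple the quarks to the time-twisted `U(3)` field `V`
  obtain ⟨V, hV⟩ : ∃ V : GaugeConfig 4 L (Matrix.unitaryGroup (Fin 3) ℂ), ∀ x μ,
      V (x, μ) =
        if μ = 0 ∧ (x 0).val = L / 2 then -unitaryLift U (x, μ) else unitaryLift U (x, μ) :=
    ⟨fun e => if e.2 = 0 ∧ (e.1 0).val = L / 2 then -unitaryLift U e else unitaryLift U e,
      fun _ _ => rfl⟩
  rw [APSmitTransferForm.wilsonDiracAP_eq_wilsonDirac U V hV m 1]
  -- (1) Lüscher's transfer-matrix form for the defining representation of `U(3)` and the field `V`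
  have h := wilson_det_transfer_form 3 L (Matrix.unitaryGroup (Fin 3) ℂ)
    (unitaryFundamentalRep (Fin 3) ℂ) unitaryFundamentalRep_mem_unitaryGroup V m hm
  simp only at h
  replace h := h.1
  -- (2) the spatial links of `V` are those of `U`: the slice blocks are those of capstone A
  have hsp : ∀ (x : TorusSite 4 L) (j : Fin 3),
      unitaryFundamentalRep (Fin 3) ℂ (V (x, j.succ)) = fundamentalRep (Fin 3) (U (x, j.succ)) :=
    fun x j => by
      rw [APSmitTransferForm.rep_twist_apply U V hV x j.succ,
        apLinkSign_of_ne_zero L x (Fin.succ_ne_zero j), one_smul]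
  have hsp' : ∀ (x : TorusSite 4 L) (j : Fin 3),
      unitaryFundamentalRep (Fin 3) ℂ (V (x, j.succ))⁻¹ =
        fundamentalRep (Fin 3) (U (x, j.succ))⁻¹ :=
    fun x j => by
      rw [APSmitTransferForm.rep_twist_inv U V hV x j.succ,
        apLinkSign_of_ne_zero L x (Fin.succ_ne_zero j), one_smul]
  simp only [hsp, hsp'] at h
  -- (3) the chain blocks `det E_t = det(w′_{t−1})² det(B_t)² = det A(U_t)²`
  have h1 := fun t : ZMod L => det_wilson_chainBlock 3 L (Matrix.unitaryGroup (Fin 3) ℂ)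
    (unitaryFundamentalRep (Fin 3) ℂ) V m t
  simp only at h1
  simp only [hsp, hsp', APSmitTransferForm.det_invTimeLink_sq U V hV, one_mul,
    ChainBlockSmit.sliceBlock_eq_reindex_sliceMassHop, Matrix.det_reindex_self] at h1
  -- (4) the dressed one-step cores `M_t = reindex (V₀ M_F(U_t) V₀⁻¹)`, `V₀ = 1 ⊗ γ₄γ₅`
  have h2 := fun t : ZMod L => dressedCore_timeSlice_eq L U m t
  simp only at h2
  -- (5) the temporal transporters `W_t = s_t · reindex G_t`
  have h3 := fun t : ZMod L => APSmitTransferForm.transporter_eq_smul_reindex U V hV t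
  simp only [h1, h2, h3] at h
  rw [h]
  congr 1
  -- (6) move the signs onto the one-particle matrices and transport the spin rotation out
  simp only [APSmitTransferForm.reindex_conj_mul_smul]
  refine (SmitTransferForm.det_one_sub_prod_reindex_conj
    (Equiv.uniqueProd (TorusSite 3 L × Fin 3 × Fin 4) (Fin 1))
    (sliceKron (Nf := 1) (S := L) 1 (euclideanGamma 0 * gammaFive))
    (sliceKron (Nf := 1) (S := L) 1 (gammaFive * euclideanGamma 0))
    (fun i : ℕ => (if ((i : ℕ) : ZMod L).val = L / 2 then (-1 : ℂ) else 1) •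
      fermionSliceMatrix (fun e : Edge 3 L => U ((Fin.cons (i : ZMod L) e.1 : TorusSite 4 L), e.2.succ))
        (fun _ : Fin 1 => m))
    (fun i : ℕ => sliceGaugeRot (Nf := 1)
      (fun y : TorusSite 3 L => U ((Fin.cons (i : ZMod L) y : TorusSite 4 L), 0)))
    L SmitTransferForm.gamma50_sliceKron_mul_gamma05_sliceKron
    SliceGammaConjugation.gamma05_sliceKron_mul_gamma50_sliceKron
    (fun i : ℕ => (sliceKron_one_mul_sliceGaugeRot_comm 1 L (euclideanGamma 0 * gammaFive)
      (fun y : TorusSite 3 L => U ((Fin.cons (i : ZMod L) y : TorusSite 4 L), 0))).symm)).trans ?_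
  -- (7) the signs multiply to `−1`: `det (1 − (−P)) = det (1 + P)`
  simp only [Matrix.smul_mul]
  rw [APSmitTransferForm.prod_map_smul
      (fun i : ℕ => if ((i : ℕ) : ZMod L).val = L / 2 then (-1 : ℂ) else 1)
      (fun i : ℕ =>
        fermionSliceMatrix (fun e : Edge 3 L => U ((Fin.cons (i : ZMod L) e.1 : TorusSite 4 L), e.2.succ))
            (fun _ : Fin 1 => m) *
          sliceGaugeRot (Nf := 1)
            (fun y : TorusSite 3 L => U ((Fin.cons (i : ZMod L) y : TorusSite 4 L), 0))) L,
    APSmitTransferForm.prod_sign L, neg_one_smul, sub_neg_eq_add]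

end Summit.QuantumFields.QCD.Cruxes.StableActionBridge.Sketch

end
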